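import Summits.BirchSwinnertonDyer.BirchSwinnertonDyer.Theorems.ByReductionTypeAtTwoOrdKatoHalfAtTwoIsoZetaColemanMuFiniteKer
import Summits.BirchSwinnertonDyer.BirchSwinnertonDyer.Theorems.AlignedTransportAtTwoMainConjectureOfRankZeroBSDAtTwoFineRoadLocalArch
import HarnessLib

/-!
# Route ByReductionTypeAtTwo, crux `OrdKatoHalfAtTwoIso` (stmt-BirchSwinnertonDyer-19573), line
# `steinberg-fibre-at-two`, RE-CUT SOCKET 2 (F1μ): the hypothesis «`ker (loc₂|_{Sel}) = Sel₀`» of the Selmer-side doors is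
# KERNEL for `ℚ` at `p = 2` — Greenberg's Prop. 2.1 (away from `2`) and the archimedean Kummer remark are the tree's
# `AlignedTransportAtTwoFineRoad.LocalArch.mem_fineSelmerInfty_iff_rat_two` (cell bsd-f1-sign2)

Seat `cruxlead-stmt-BirchSwinnertonDyer-19573-w3` (prover WIDTH under the LEAD `cruxlead-19573`; HOME `run/shared/lean/pub/bsd-2adic/`;
`--supports` stmt-BirchSwinnertonDyer-23890 `OrdKatoFineZetaAtTwoResidue` = F1μ). HONEST FRAMING: BSD is not proved by any of this; F1μ
and the crux are NOT proved; kernel adapters only (no definition, no named fact, no `sorry`).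

WHY THIS FILE. The doors p682177 (`hasZetaColemanMuInputsAtTwo_of_localDualPair[_generators]`) and p685098
(`mu_eq_zero_of_localDualPair_finiteKer`) take the localisation `φ : Sel_{2^∞}(E/ℚ_∞) → S` at the prime above `2` with the
hypothesis `hker : φ s = 0 ↔ s ∈ Sel₀(ℚ_∞, E[2^∞])` — input F1-P21 of the typing brief (Greenberg LNM 1716 Prop. 2.1 over
`ℚ_∞` + the archimedean Kummer remark). That input is ALREADY KERNEL in the tree, proved by the AlignedTransportAtTwo cell:
`LocalArch.mem_fineSelmerInfty_iff_rat_two` — for `K = ℚ`, `p = 2`, EVERY elliptic `W` and EVERY `ℤ₂`-extension `κ`,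
`Sel₀ = Sel ∩ (restricts to 0 on Gal(ℚ̄/ℚ_∞) ⊓ D_v for the places v ∣ 2, all conjugates)` with NO archimedean term
(`LocalAway.localKerOver_eq_awayKer`: away from `2` the classical Kummer condition IS local triviality;
`LocalArch.localKerOver_two_eq_infKer`: so is it at the real places). Hence `hker` reduces to the NATURAL description of
the kernel of a localisation map at `2` — «`φ s = 0` iff `conj_σ s` restricts to `0` on every decomposition group above `2`»
(`hker_of_kernel_above_two`) — and the two doors are restated with that hypothesis (`…_locTwo`). After this file the
residual inputs of F1μ are (L) the local Coleman dual pair at `2` proper (Kato 17.9/17.11 + Λ-adic local duality), (R) the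
reciprocity sum, (E) the zeta image clause — F1-P21 is no longer on the list.

References: [GreenbergLNM1716] §2 Prop. 2.1 and (2) (p. 72), §4 p. 106; [CoatesSujatha2005] §3; tree
`…AlignedTransportAtTwoMainConjectureOfRankZeroBSDAtTwoFineRoadLocalAway.lean` / `…LocalArch.lean` (bsd-f1-sign2, att-p4),
p682177, p685098.
-/

set_option autoImplicit false
set_option linter.dupNamespace false

noncomputable section

open scoped Classical MatrixGroups ModularForm NumberField
open CongruenceSubgroup WeierstrassCurve Field IsDedekindDomain
open Literature.NumberTheory.GaloisRepresentations
open Literature.NumberTheory.EllipticCurves Literature.NumberTheory.EllipticCurves.ModularForms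
  Literature.NumberTheory.EllipticCurves.GreenbergSelmer
open Literature.NumberTheory.EllipticCurves.Kato2004
  Literature.NumberTheory.EllipticCurves.Kato2004.EulerSystemValues
open Literature.NumberTheory.EllipticCurves.IwasawaDual
open Literature.NumberTheory.EllipticCurves.Rank1Residual
open Summit.BirchSwinnertonDyer.Rank1Residual Summit.BirchSwinnertonDyer.Rank1Residual.X5
open Summit.BirchSwinnertonDyer.BirchSwinnertonDyer.Theorems.AlignedTransportAtTwoFineRoad

namespace Summit.BirchSwinnertonDyer.BirchSwinnertonDyer.Theorems.SteinbergFibreAtTwo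

section LocTwo

variable {W : WeierstrassCurve ℚ} [W.IsElliptic] {κ : ZpExtension ℚ 2}

/-- **F1-P21 in the kernel**: for a map `φ` on `Sel_{2^∞}(E/ℚ_∞)` whose kernel is «`conj_σ s` restricts to `0` on
`Gal(ℚ̄/ℚ_∞) ⊓ D_v` for every place `v ∣ 2` and every `σ`» (the kernel of any localisation at the prime above `2`), one has
`φ s = 0 ↔ s ∈ Sel₀(ℚ_∞, E[2^∞])` — by `LocalArch.mem_fineSelmerInfty_iff_rat_two` (Greenberg Prop. 2.1 away from `2` and
the archimedean Kummer remark, both kernel). Any elliptic `W/ℚ`, any `ℤ₂`-extension.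
[cite: GreenbergLNM1716, §2 Prop. 2.1 and (2) (p. 72)] [cite: CoatesSujatha2005, §3] -/
theorem hker_of_kernel_above_two {S : Type*} [AddCommGroup S] (φ : W.selmerInfty κ →+ S)
    (hφ : ∀ s : W.selmerInfty κ, φ s = 0 ↔
      ∀ (v : HeightOneSpectrum (𝓞 ℚ)), ((2 : ℕ) : 𝓞 ℚ) ∈ v.asIdeal → ∀ σ : absoluteGaloisGroup ℚ,
        W.conjH1 2 κ.kerSubgroup σ (s : W.subgroupH1 2 κ.kerSubgroup) ∈
          awayKer κ.kerSubgroup (W.geomPrimaryTorsion 2) v) :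
    ∀ s : W.selmerInfty κ, φ s = 0 ↔ (s : W.subgroupH1 2 κ.kerSubgroup) ∈ W.fineSelmerInfty κ := by
  intro s
  rw [hφ s, LocalArch.mem_fineSelmerInfty_iff_rat_two]
  exact ⟨fun h => ⟨s.2, h⟩, fun h => h.2⟩

end LocTwo

section Doors

variable {W : WeierstrassCurve ℚ} [W.IsElliptic] [W.IsGloballyMinimal]
  [ContinuousSMul ℤ_[2] (W.tateModule 2)] [Module.Free ℤ_[2] (W.tateModule 2)]
  [Module.Finite ℤ_[2] (W.tateModule 2)] {N : ℕ} {f : CuspForm (Gamma0 N) 2}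
  {κ : ZpExtension ℚ 2} {γ : absoluteGaloisGroup ℚ} {hκ : κ.IsCyclotomic}

/-- **The Selmer-side door with `φ = loc₂` described by its kernel** (p682177 `…_of_localDualPair_generators` +
`hker_of_kernel_above_two`): `HasZetaColemanMuInputsAtTwo W f κ γ hκ D Y` from (L) a local Coleman dual pair at `2` whose
localisation `φ` has kernel «restriction to every decomposition group above `2` vanishes», (R) reciprocity on generators,
(E) the one-class image clause. Kernel; nothing asserted.
[cite: Kato2004Asterisque, (14.9.3) (p. 240), Prop. 17.11 (p. 277), §17.13 (pp. 279–280)] [cite: GreenbergLNM1716, §2 Prop. 2.1 (p. 72)] -/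
theorem hasZetaColemanMuInputsAtTwo_of_localDualPair_locTwo (D : W.SelmerDualData κ γ) (Y : W.FineSelmerDualData κ γ)
    (I : IwasawaH1Data W 2 κ γ) (G : Set I.H) (hG : ∀ g ∈ G, IsEulerSystemClassTwo W hκ I g)
    {P₀ : Type*} [AddCommGroup P₀] [Module (IwasawaAlgebra 2) P₀] {S : Type*} [AddCommGroup S]
    {ψ : AddMonoid.End S} {toDualP : P₀ →+ (S →+ AddCircle (1 : ℚ))} (hP : IsDualPair 2 ψ toDualP)
    (col : P₀ →ₗ[IwasawaAlgebra 2] IwasawaAlgebra 2) (hcol : Function.Injective col)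
    (φ : W.selmerInfty κ →+ S) (hφ : ∀ s, φ ((W.conjSelmerInfty κ γ - 1) s) = ψ (φ s))
    (hφker : ∀ s : W.selmerInfty κ, φ s = 0 ↔
      ∀ (v : HeightOneSpectrum (𝓞 ℚ)), ((2 : ℕ) : 𝓞 ℚ) ∈ v.asIdeal → ∀ σ : absoluteGaloisGroup ℚ,
        W.conjH1 2 κ.kerSubgroup σ (s : W.subgroupH1 2 κ.kerSubgroup) ∈
          awayKer κ.kerSubgroup (W.geomPrimaryTorsion 2) v)
    (ℓ₀ : I.H →ₗ[IwasawaAlgebra 2] P₀)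
    (hrecG : ∀ g ∈ G, ∀ s : W.selmerInfty κ, toDualP (ℓ₀ g) (φ s) = 0)
    (himgG : ∀ G₁ : IwasawaAlgebra 2,
      iwasawaToPowerSeries 2 G₁ = padicLFunction f (unitRoot W 2 : ℚ_[2]) →
        ∃ g ∈ G, ∃ s : IwasawaAlgebra 2, s ∉ IwasawaAlgebra.augIdealP 2 ∧ col (ℓ₀ g) = s * G₁) :
    HasZetaColemanMuInputsAtTwo W f κ γ hκ D Y :=
  hasZetaColemanMuInputsAtTwo_of_localDualPair_generators D Y I G hG hP col hcol φ hφ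
    (hker_of_kernel_above_two φ hφker) ℓ₀ hrecG himgG

/-- **The finite-kernel `μ = 0` door with `φ = loc₂` described by its kernel** (p685098 `mu_eq_zero_of_localDualPair_finiteKer` +
`hker_of_kernel_above_two`), for `W` good ordinary at `2`, `ρ̄₂` onto, `Δ_W < 0`, any Selmer dual datum `D`. Kernel.
[cite: Kato2004Asterisque, Prop. 17.11 (p. 277), §17.13 (pp. 279–280)] [cite: GreenbergLNM1716, §2 Prop. 2.1 (p. 72)] -/
theorem mu_eq_zero_of_localDualPair_finiteKer_locTwo [NeZero N] (hgo : GoodOrd W 2)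
    (h2 : W.HasSurjectiveModNGaloisRep 2) (hΔ : W.Δ < 0) (hf : IsNewformOf W f) (hγ : κ.IsTopGenerator γ)
    (D : W.SelmerDualData κ γ) (I : IwasawaH1Data W 2 κ γ) (G : Set I.H)
    (hG : ∀ g ∈ G, IsEulerSystemClassTwo W hκ I g)
    {P₀ : Type*} [AddCommGroup P₀] [Module (IwasawaAlgebra 2) P₀] {S : Type*} [AddCommGroup S]
    {ψ : AddMonoid.End S} {toDualP : P₀ →+ (S →+ AddCircle (1 : ℚ))} (hP : IsDualPair 2 ψ toDualP)
    (col : P₀ →ₗ[IwasawaAlgebra 2] IwasawaAlgebra 2) (hcol : Finite (LinearMap.ker col))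
    (φ : W.selmerInfty κ →+ S) (hφ : ∀ s, φ ((W.conjSelmerInfty κ γ - 1) s) = ψ (φ s))
    (hφker : ∀ s : W.selmerInfty κ, φ s = 0 ↔
      ∀ (v : HeightOneSpectrum (𝓞 ℚ)), ((2 : ℕ) : 𝓞 ℚ) ∈ v.asIdeal → ∀ σ : absoluteGaloisGroup ℚ,
        W.conjH1 2 κ.kerSubgroup σ (s : W.subgroupH1 2 κ.kerSubgroup) ∈
          awayKer κ.kerSubgroup (W.geomPrimaryTorsion 2) v)
    (ℓ₀ : I.H →ₗ[IwasawaAlgebra 2] P₀)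
    (hrecG : ∀ g ∈ G, ∀ s : W.selmerInfty κ, toDualP (ℓ₀ g) (φ s) = 0)
    (himgG : ∀ G₁ : IwasawaAlgebra 2,
      iwasawaToPowerSeries 2 G₁ = padicLFunction f (unitRoot W 2 : ℚ_[2]) →
        ∃ g ∈ G, ∃ s : IwasawaAlgebra 2, s ∉ IwasawaAlgebra.augIdealP 2 ∧ col (ℓ₀ g) = s * G₁) :
    D.mu = 0 :=
  mu_eq_zero_of_localDualPair_finiteKer hgo h2 hΔ hf hγ D I G hG hP col hcol φ hφ
    (hker_of_kernel_above_two φ hφker) ℓ₀ hrecG himgG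

end Doors

end Summit.BirchSwinnertonDyer.BirchSwinnertonDyer.Theorems.SteinbergFibreAtTwo

end
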